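import Summits.ValiantsHypothesis.ValiantsHypothesis.Theorems.KPlusLogSqLawTropicalPermutationChanges

/-!
# Route «KPlusLogSqLaw», crux `TropicalB` (stmt-ValiantsHypothesis-19771) — the attack foothold `stub_tropTowerLog` IS A
# `2^(O(K))` BUDGET ON PERMUTATION TURNOVER at the tower format `(K·⌊log₂ K⌋, K)`

HONEST FRAMING.  Helper toward the registered attack-foothold stub `stub_tropTowerLog` of `Cruxes/TropicalB/Lines/birth.lean`
(`∃ C, ∀ K, TropRow (K·⌊log₂ K⌋) K (2^(C·K))`, `TropRow = TropicalCensus.TropRootLawAt` by `Iff.rfl`; crux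
`Summit.ValiantsHypothesis.ValiantsHypothesis.Theses.KPlusLogSqLaw.TropicalB`, item stmt-ValiantsHypothesis-19771, route KPlusLogSqLaw;
hand leafhand-val-kpluslogsqlaw-1 g18, 2026-09-01; `--supports … --as helper`).  EQUIVALENCES between OPEN statements, obtained from the
tree's two turnover laws (val-sym-lift-p2, `…TropicalPermutationChanges`): `le_permChanges_add` (`n ≤ P + m²(K−1)`, `P` = number of
permutation-CHANGING steps of the chain) and `succ_le_card_perms_mul` (`n + 1 ≤ F·(m(K−1)+1)`, `F` = number of DISTINCT permutations).
At the tower format `m = K·⌊log₂ K⌋` both additive / multiplicative losses are `≤ K⁵ ≤ 2^(5K)` resp. `≤ K³ + 1 ≤ 2^(3K)`, i.e. inside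
the foothold's own budget `2^(O(K))` (whereas slope counting there is `2^(Θ(K·log log K))`).  Hence — the foothold-level twin of
`tropicalB_iff_permSteps` / `tropicalB_iff_cardPerms` (`…TropicalBPermutationBudget`, which does this for the crux with budget
`2^(C(K + log² m))`):

* `TowerLogPermBudget.towerLog_iff_permSteps` — the foothold ⟺ «∃ C, every sign-alternating dominant chain of every design of format
  `(K·⌊log₂ K⌋, K)` changes its permutation at most `2^(C·K)` times»;
* `TowerLogPermBudget.towerLog_iff_cardPerms` — the foothold ⟺ «∃ C, every such chain uses at most `2^(C·K)` DISTINCT permutations», i.e.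
  a `K`-slope-class parametric assignment instance on `K·⌊log₂ K⌋` nodes meets at most `2^(O(K))` distinct optimal assignments along an
  increasing parameter (counted with the sign-alternation convention of the census).

Nothing here proves or refutes the foothold; nothing bears on `TropicalB` in its window, `WeakLifting`, `Lifting`, `MatrixDescartes`
(stmt-ValiantsHypothesis-18050) or VP ≠ VNP.  READING (docstrings only): a refutation of the foothold must turn over `2^(ω(K))` optimal
PERMUTATIONS on `K log K` nodes (class flips at a fixed permutation are `≤ K⁵` in total there); the cell's families turn over `O(m)`
permutations per `O(1)` classes (SHIFT-THREE) or `n^(K−2)` on `4^K n²` rows (staircase).  [folklore: bookkeeping over the two cited tree laws]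
-/

set_option linter.dupNamespace false
set_option autoImplicit false

namespace Summit.ValiantsHypothesis.ValiantsHypothesis.Theorems.KPlusLogSqLaw

namespace TowerLogPermBudget

open Summit.ValiantsHypothesis.ValiantsHypothesis.Theorems.LacunarySymmetroidMatrixDescartes.TropicalCensus
open Summit.ValiantsHypothesis.ValiantsHypothesis.Theorems.MatrixDescartes.Negative
open Finset

/-! ## 0. Arithmetic at the tower format `m = K·⌊log₂ K⌋` -/

/-- `K·⌊log₂ K⌋ ≤ K·K`. [arithmetic] -/
theorem tower_le_sq (K : ℕ) : K * Nat.log 2 K ≤ K * K :=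
  Nat.mul_le_mul_left K (Nat.log_le_self 2 K)

/-- The class-switch budget at the tower format is exponentially small: `m·m·(K−1) ≤ 2^(5K)` for `m = K·⌊log₂ K⌋`. [arithmetic] -/
theorem switch_budget_le (K : ℕ) : K * Nat.log 2 K * (K * Nat.log 2 K) * (K - 1) ≤ 2 ^ (5 * K) := by
  have h1 : K * Nat.log 2 K ≤ K * K := tower_le_sq K
  have h2 : K - 1 ≤ K := Nat.sub_le K 1
  have h3 : K * Nat.log 2 K * (K * Nat.log 2 K) * (K - 1) ≤ K * K * (K * K) * K :=
    Nat.mul_le_mul (Nat.mul_le_mul h1 h1) h2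
  have h4 : K * K * (K * K) * K = K ^ 5 := by ring
  have h5 : K ^ 5 ≤ (2 ^ K) ^ 5 := Nat.pow_le_pow_left Nat.lt_two_pow_self.le 5
  have h6 : (2 ^ K) ^ 5 = 2 ^ (5 * K) := by rw [← pow_mul]; ring_nf
  calc K * Nat.log 2 K * (K * Nat.log 2 K) * (K - 1) ≤ K * K * (K * K) * K := h3
    _ = K ^ 5 := h4
    _ ≤ (2 ^ K) ^ 5 := h5
    _ = 2 ^ (5 * K) := h6

/-- The permutation-fibre factor at the tower format is exponentially small: `m·(K−1) + 1 ≤ 2^(3K)` for `m = K·⌊log₂ K⌋`. [arithmetic] -/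
theorem fibre_factor_le (K : ℕ) : K * Nat.log 2 K * (K - 1) + 1 ≤ 2 ^ (3 * K) := by
  rcases Nat.eq_zero_or_pos K with rfl | hK
  · simp
  have h1 : K * Nat.log 2 K ≤ K * K := tower_le_sq K
  have h2 : K - 1 ≤ K := Nat.sub_le K 1
  have h3 : K * Nat.log 2 K * (K - 1) ≤ K * K * K := Nat.mul_le_mul h1 h2
  have h4 : K * K * K = K ^ 3 := by ring
  have h5 : K ^ 3 < (2 ^ K) ^ 3 := Nat.pow_lt_pow_left Nat.lt_two_pow_self three_ne_zero
  have h6 : (2 ^ K) ^ 3 = 2 ^ (3 * K) := by rw [← pow_mul]; ring_nf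
  calc K * Nat.log 2 K * (K - 1) + 1 ≤ K * K * K + 1 := Nat.add_le_add_right h3 1
    _ = K ^ 3 + 1 := by rw [h4]
    _ ≤ (2 ^ K) ^ 3 := h5
    _ = 2 ^ (3 * K) := h6

/-- Sum of two exponential budgets: `2^(C K) + 2^(5 K) ≤ 2^((C+6) K)` for `K ≥ 1`. [arithmetic] -/
theorem two_pow_add_le (C K : ℕ) (hK : 1 ≤ K) : 2 ^ (C * K) + 2 ^ (5 * K) ≤ 2 ^ ((C + 6) * K) := by
  have h1 : 2 ^ (C * K) ≤ 2 ^ ((C + 5) * K) := Nat.pow_le_pow_right two_pos (by nlinarith)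
  have h2 : 2 ^ (5 * K) ≤ 2 ^ ((C + 5) * K) := Nat.pow_le_pow_right two_pos (by nlinarith)
  calc 2 ^ (C * K) + 2 ^ (5 * K) ≤ 2 ^ ((C + 5) * K) + 2 ^ ((C + 5) * K) := Nat.add_le_add h1 h2
    _ = 2 ^ ((C + 5) * K + 1) := by rw [pow_succ]; ring
    _ ≤ 2 ^ ((C + 6) * K) := Nat.pow_le_pow_right two_pos (by nlinarith)

/-! ## 1. Permutation-changing steps -/

/-- **Permutation-step budget ⇒ the foothold.**  If every sign-alternating dominant chain of every design of format `(K·⌊log₂ K⌋, K)`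
changes its permutation at most `2^(C·K)` times, then `T(K·⌊log₂ K⌋, K) ≤ 2^((C+6)·K)` for all `K`: the other steps are class switches at a
fixed permutation, at most `m²(K−1) ≤ 2^(5K)` of them (`le_permChanges_add`). [folklore: bookkeeping] -/
theorem towerLog_of_permSteps
    (h : ∃ C : ℕ, ∀ (K : ℕ) (d : Fin K → ℕ)
      (v ε : Fin (K * Nat.log 2 K) → Fin (K * Nat.log 2 K) → Fin K → ℤ) (n : ℕ) (θ : Fin (n + 1) → ℤ)
      (p : Fin (n + 1) → Equiv.Perm (Fin (K * Nat.log 2 K)) × (Fin (K * Nat.log 2 K) → Fin K)),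
      (∀ i j l, (ε i j l).natAbs ≤ 1) → StrictMono θ → (∀ k, IsDominant d v ε (θ k) (p k)) →
      (∀ k : Fin n, termSign ε (p k.castSucc) * termSign ε (p k.succ) < 0) →
      (univ.filter fun k : Fin n => (p k.castSucc).1 ≠ (p k.succ).1).card ≤ 2 ^ (C * K)) :
    ∃ C : ℕ, ∀ K : ℕ, TropRootLawAt (K * Nat.log 2 K) K (2 ^ (C * K)) := by
  classical
  obtain ⟨C, hC⟩ := h
  refine ⟨C + 6, fun K => ?_⟩
  rcases Nat.eq_zero_or_pos K with rfl | hKpos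
  · exact tropRootLawAt_zero _ _
  intro d v ε n θ p hε hθ hdom halt
  have h1 := le_permChanges_add d v ε n θ p hθ hdom halt
  have h2 := hC K d v ε n θ p hε hθ hdom halt
  have h3 := switch_budget_le K
  have h4 := two_pow_add_le C K hKpos
  omega

/-- **The foothold ⇒ permutation-step budget** (same constant): permutation-changing steps are a subset of all steps. [folklore] -/
theorem permSteps_of_towerLog (h : ∃ C : ℕ, ∀ K : ℕ, TropRootLawAt (K * Nat.log 2 K) K (2 ^ (C * K))) :
    ∃ C : ℕ, ∀ (K : ℕ) (d : Fin K → ℕ)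
      (v ε : Fin (K * Nat.log 2 K) → Fin (K * Nat.log 2 K) → Fin K → ℤ) (n : ℕ) (θ : Fin (n + 1) → ℤ)
      (p : Fin (n + 1) → Equiv.Perm (Fin (K * Nat.log 2 K)) × (Fin (K * Nat.log 2 K) → Fin K)),
      (∀ i j l, (ε i j l).natAbs ≤ 1) → StrictMono θ → (∀ k, IsDominant d v ε (θ k) (p k)) →
      (∀ k : Fin n, termSign ε (p k.castSucc) * termSign ε (p k.succ) < 0) →
      (univ.filter fun k : Fin n => (p k.castSucc).1 ≠ (p k.succ).1).card ≤ 2 ^ (C * K) := by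
  classical
  obtain ⟨C, hC⟩ := h
  refine ⟨C, fun K d v ε n θ p hε hθ hdom halt => ?_⟩
  have h1 : n ≤ 2 ^ (C * K) := hC K d v ε n θ p hε hθ hdom halt
  calc (univ.filter fun k : Fin n => (p k.castSucc).1 ≠ (p k.succ).1).card ≤ (univ : Finset (Fin n)).card :=
        card_filter_le _ _
    _ = n := by rw [card_univ, Fintype.card_fin]
    _ ≤ 2 ^ (C * K) := h1

/-- **The foothold ⟺ the permutation-step budget at the tower format.**  `stub_tropTowerLog`'s statement (`TropRow = TropRootLawAt` by
`Iff.rfl`) is equivalent to: for some absolute `C`, every sign-alternating dominant chain of every dominance design of format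
`(K·⌊log₂ K⌋, K)` changes its PERMUTATION at most `2^(C·K)` times.  Class flips never decide the foothold. [folklore: bookkeeping] -/
theorem towerLog_iff_permSteps :
    (∃ C : ℕ, ∀ K : ℕ, TropRootLawAt (K * Nat.log 2 K) K (2 ^ (C * K))) ↔
    ∃ C : ℕ, ∀ (K : ℕ) (d : Fin K → ℕ)
      (v ε : Fin (K * Nat.log 2 K) → Fin (K * Nat.log 2 K) → Fin K → ℤ) (n : ℕ) (θ : Fin (n + 1) → ℤ)
      (p : Fin (n + 1) → Equiv.Perm (Fin (K * Nat.log 2 K)) × (Fin (K * Nat.log 2 K) → Fin K)),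
      (∀ i j l, (ε i j l).natAbs ≤ 1) → StrictMono θ → (∀ k, IsDominant d v ε (θ k) (p k)) →
      (∀ k : Fin n, termSign ε (p k.castSucc) * termSign ε (p k.succ) < 0) →
      (univ.filter fun k : Fin n => (p k.castSucc).1 ≠ (p k.succ).1).card ≤ 2 ^ (C * K) :=
  ⟨permSteps_of_towerLog, towerLog_of_permSteps⟩

/-! ## 2. Distinct permutations -/

/-- **Distinct-permutation budget ⇒ the foothold.**  If every sign-alternating dominant chain of format `(K·⌊log₂ K⌋, K)` uses at most
`2^(C·K)` distinct permutations, then `T(K·⌊log₂ K⌋, K) ≤ 2^((C+3)·K)`: each permutation carries at most `m(K−1) + 1 ≤ 2^(3K)` chain terms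
(`succ_le_card_perms_mul`). [folklore: bookkeeping] -/
theorem towerLog_of_cardPerms
    (h : ∃ C : ℕ, ∀ (K : ℕ) (d : Fin K → ℕ)
      (v ε : Fin (K * Nat.log 2 K) → Fin (K * Nat.log 2 K) → Fin K → ℤ) (n : ℕ) (θ : Fin (n + 1) → ℤ)
      (p : Fin (n + 1) → Equiv.Perm (Fin (K * Nat.log 2 K)) × (Fin (K * Nat.log 2 K) → Fin K)),
      (∀ i j l, (ε i j l).natAbs ≤ 1) → StrictMono θ → (∀ k, IsDominant d v ε (θ k) (p k)) →
      (∀ k : Fin n, termSign ε (p k.castSucc) * termSign ε (p k.succ) < 0) →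
      (univ.image fun k => (p k).1).card ≤ 2 ^ (C * K)) :
    ∃ C : ℕ, ∀ K : ℕ, TropRootLawAt (K * Nat.log 2 K) K (2 ^ (C * K)) := by
  classical
  obtain ⟨C, hC⟩ := h
  refine ⟨C + 3, fun K => ?_⟩
  intro d v ε n θ p hε hθ hdom halt
  have h1 := succ_le_card_perms_mul d v ε n θ p hθ hdom halt
  have h2 := hC K d v ε n θ p hε hθ hdom halt
  have h3 := fibre_factor_le K
  have h4 : n + 1 ≤ 2 ^ (C * K) * 2 ^ (3 * K) := h1.trans (Nat.mul_le_mul h2 h3)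
  rw [← pow_add] at h4
  have h5 : C * K + 3 * K = (C + 3) * K := by ring
  rw [h5] at h4
  omega

/-- **The foothold ⇒ distinct-permutation budget** (with `C + 1`): a chain of `n + 1` terms uses at most `n + 1 ≤ 2^(C K) + 1 ≤ 2^((C+1) K)`
permutations when `K ≥ 1`; at `K = 0` the format is `(0, 0)` and there is exactly one permutation of `Fin 0`. [folklore: bookkeeping] -/
theorem cardPerms_of_towerLog (h : ∃ C : ℕ, ∀ K : ℕ, TropRootLawAt (K * Nat.log 2 K) K (2 ^ (C * K))) :
    ∃ C : ℕ, ∀ (K : ℕ) (d : Fin K → ℕ)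
      (v ε : Fin (K * Nat.log 2 K) → Fin (K * Nat.log 2 K) → Fin K → ℤ) (n : ℕ) (θ : Fin (n + 1) → ℤ)
      (p : Fin (n + 1) → Equiv.Perm (Fin (K * Nat.log 2 K)) × (Fin (K * Nat.log 2 K) → Fin K)),
      (∀ i j l, (ε i j l).natAbs ≤ 1) → StrictMono θ → (∀ k, IsDominant d v ε (θ k) (p k)) →
      (∀ k : Fin n, termSign ε (p k.castSucc) * termSign ε (p k.succ) < 0) →
      (univ.image fun k => (p k).1).card ≤ 2 ^ (C * K) := by
  classical
  obtain ⟨C, hC⟩ := h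
  refine ⟨C + 1, fun K d v ε n θ p hε hθ hdom halt => ?_⟩
  have h1 : n ≤ 2 ^ (C * K) := hC K d v ε n θ p hε hθ hdom halt
  rcases Nat.eq_zero_or_pos K with rfl | hK
  · -- format `(0, 0)`: `Equiv.Perm (Fin 0)` has exactly one element
    have hcard : Fintype.card (Equiv.Perm (Fin (0 * Nat.log 2 0))) = 1 := by
      rw [Fintype.card_perm, Fintype.card_fin]
      simp
    calc (univ.image fun k => (p k).1).card ≤ (univ : Finset (Equiv.Perm (Fin (0 * Nat.log 2 0)))).card := card_le_univ _
      _ = 1 := by rw [card_univ, hcard]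
      _ ≤ 2 ^ ((C + 1) * 0) := by simp
  · calc (univ.image fun k => (p k).1).card ≤ (univ : Finset (Fin (n + 1))).card := card_image_le
      _ = n + 1 := by rw [card_univ, Fintype.card_fin]
      _ ≤ 2 ^ (C * K) + 2 ^ (C * K) := Nat.add_le_add h1 Nat.one_le_two_pow
      _ = 2 ^ (C * K + 1) := by rw [pow_succ]; ring
      _ ≤ 2 ^ ((C + 1) * K) := Nat.pow_le_pow_right two_pos (by nlinarith)

/-- **The foothold ⟺ the distinct-permutation budget at the tower format.**  `stub_tropTowerLog`'s statement is equivalent to: for some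
absolute `C`, every sign-alternating dominant chain of every dominance design of format `(K·⌊log₂ K⌋, K)` uses at most `2^(C·K)` DISTINCT
permutations — a bound on the number of distinct optimal assignments of a `K`-slope-class parametric assignment instance on `K·⌊log₂ K⌋`
nodes met along an increasing parameter, and about nothing else. [folklore: bookkeeping] -/
theorem towerLog_iff_cardPerms :
    (∃ C : ℕ, ∀ K : ℕ, TropRootLawAt (K * Nat.log 2 K) K (2 ^ (C * K))) ↔
    ∃ C : ℕ, ∀ (K : ℕ) (d : Fin K → ℕ)
      (v ε : Fin (K * Nat.log 2 K) → Fin (K * Nat.log 2 K) → Fin K → ℤ) (n : ℕ) (θ : Fin (n + 1) → ℤ)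
      (p : Fin (n + 1) → Equiv.Perm (Fin (K * Nat.log 2 K)) × (Fin (K * Nat.log 2 K) → Fin K)),
      (∀ i j l, (ε i j l).natAbs ≤ 1) → StrictMono θ → (∀ k, IsDominant d v ε (θ k) (p k)) →
      (∀ k : Fin n, termSign ε (p k.castSucc) * termSign ε (p k.succ) < 0) →
      (univ.image fun k => (p k).1).card ≤ 2 ^ (C * K) :=
  ⟨cardPerms_of_towerLog, towerLog_of_cardPerms⟩

end TowerLogPermBudget

end Summit.ValiantsHypothesis.ValiantsHypothesis.Theorems.KPlusLogSqLaw
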